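import Summits.BirchSwinnertonDyer.BirchSwinnertonDyer.Theses.PrintX10b
import Literature.NumberTheory.EllipticCurves.ModularParametrizationTrustBaseProofs
import Literature.NumberTheory.EllipticCurves.ModularParametrizationDegreeHoldsProofs
import Literature.NumberTheory.EllipticCurves.ModularParametrizationBCDTProofs
import HarnessLib

/-!
# Route `PrintX10b`, support item `PrintFactsX10b` (stmt-BirchSwinnertonDyer-20684): the SLIMMED
# dependency list — the seven-conjunct cyclotomic print bundle with ONE modularity display

D-0154 (2) INPUTS→UNCONDITIONAL, `INPUTS-LIST-2.md` §4 T1 «PackSlim» (cell `pub/bsd-wall`, seat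
`bsd-inputs-pack-p1`). `PrintFactsX10b` is the conjunction of seven published facts: Yan–Zhu 2026
Thm 4.9 (`YZRationalMainConjectureOdd`, 20686), Mazur 1978 Cor. 4.1 (`MazurManinConstantOdd`, 19383),
Schneider 1985 at odd `p` (`SchneiderOrderCharGeneratorOdd`, 19470), Perrin-Riou rank-one leading terms
at odd `p` (`PerrinRiouRankOneLeadingTermsOdd`, 19471), modular parametrisation data
(`ModularParametrizationSupply`, 19266), Gross–Zagier–Kolyvagin (`RankEqAnalyticRankLeOne`, 19921),
Kato's fine-quotient zeta divisibility inputs (`KatoZetaFineQuotientInputs`, 19843). The SAME route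
displays the Modularity Theorem a second time as the newform `NewformExistence` (19382, conjunct 10 of
`HeegnerPrintFactsX10b` 21206), and over the tree's LANDED theorems the two displays are equivalent:
the newform gives the datum (`ModularForms.nonempty_modularParametrizationData_of_exists_isNewformOf`
with the DISCHARGED rational Manin constant `ModularForms.IsNewformOf.exists_maninConstant_ne_zero_holds`,
BCDT 2001 p. 845 (2) ⇒ (6)), and the datum gives the newform
(`ModularForms.exists_isNewformOf_of_nonempty_modularParametrizationData`, (6) ⇒ (2)).

Theorems: `printFactsX10b_of_slim` — the bundle from seven registered items with the modularity display
unified to `NewformExistence` (route-level distinct displays 7 + 10 → one fewer); the in-route edges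
`printX10b_modularParametrizationSupply_of_newformExistence` and
`printX10b_newformExistence_of_modularParametrizationSupply`. HONEST FRAMING: pure glue over landed
theorems; no cite-only fact is proved here (Kato 2004 stays a displayed input, excluded from proving
wholesale by ruling); the seven inputs stay print hypotheses and the route stays conditional on them AS
TYPED. Nothing here proves BSD; BSD is not proved by any of this.
-/

set_option autoImplicit false
set_option linter.dupNamespace false

namespace Summit.BirchSwinnertonDyer.BirchSwinnertonDyer.Theorems

open Literature.NumberTheory.EllipticCurves
open Summit.BirchSwinnertonDyer.BirchSwinnertonDyer.Theses.PrintX10b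

/-- In-route edge: `NewformExistence` (19382) gives `ModularParametrizationSupply` (19266), by
`ModularForms.nonempty_modularParametrizationData_of_exists_isNewformOf` with the discharged rational
Manin constant `ModularForms.IsNewformOf.exists_maninConstant_ne_zero_holds`. [folklore] -/
theorem printX10b_modularParametrizationSupply_of_newformExistence (hnf : NewformExistence) :
    Summit.BirchSwinnertonDyer.BirchSwinnertonDyer.Theses.PrintX10b.ModularParametrizationSupply :=
  ModularForms.nonempty_modularParametrizationData_of_exists_isNewformOf hnf
    ModularForms.IsNewformOf.exists_maninConstant_ne_zero_holds

/-- In-route edge, converse: `ModularParametrizationSupply` (19266) gives `NewformExistence` (19382), by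
`ModularForms.exists_isNewformOf_of_nonempty_modularParametrizationData`. [folklore] -/
theorem printX10b_newformExistence_of_modularParametrizationSupply (hmod : ModularParametrizationSupply) :
    Summit.BirchSwinnertonDyer.BirchSwinnertonDyer.Theses.PrintX10b.NewformExistence :=
  ModularForms.exists_isNewformOf_of_nonempty_modularParametrizationData hmod

/-- **`PrintFactsX10b` from seven registered items with ONE modularity display** (route `PrintX10b`,
item stmt-BirchSwinnertonDyer-20684; INPUTS-LIST-2 T1): `YZRationalMainConjectureOdd`,
`MazurManinConstantOdd`, `SchneiderOrderCharGeneratorOdd`, `PerrinRiouRankOneLeadingTermsOdd`,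
`NewformExistence` (in place of conjunct 5, the parametrisation datum, which is the tree theorem
`printX10b_modularParametrizationSupply_of_newformExistence` over it), `RankEqAnalyticRankLeOne`,
`KatoZetaFineQuotientInputs`. Pure glue; the seven hypotheses remain print inputs. [folklore] -/
theorem printFactsX10b_of_slim
    (hYZ : YZRationalMainConjectureOdd) (hMazur : MazurManinConstantOdd)
    (hSch : SchneiderOrderCharGeneratorOdd) (hPR : PerrinRiouRankOneLeadingTermsOdd)
    (hnf : NewformExistence) (hGZK : RankEqAnalyticRankLeOne) (hKato : KatoZetaFineQuotientInputs) :
    Summit.BirchSwinnertonDyer.BirchSwinnertonDyer.Theses.PrintX10b.PrintFactsX10b :=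
  ⟨hYZ, hMazur, hSch, hPR, printX10b_modularParametrizationSupply_of_newformExistence hnf, hGZK, hKato⟩

end Summit.BirchSwinnertonDyer.BirchSwinnertonDyer.Theorems
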